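import Mathlib
import HarnessLib
import Summits.Ventures.LatticeQCDFlow.Exactness.NCMCGeneralSpaceTwoSampleCLT
import Summits.Ventures.LatticeQCDFlow.Exactness.NCMCGeneralSpaceStudentizedCLT

/-!
# The two-sample (BAR-type) error bar is asymptotically honest: studentizing by the two Kish fractions

HONEST FRAMING: exact (Metropolis-corrected) sampling algorithms for lattice gauge theory;
figures of merit are autocorrelation/cost numbers at stated couplings and volumes; no
continuum-physics claim.

Venture `LatticeQCDFlow` (cell pub-lqcd), topic `Exactness`; FANOUT row 13 (`eng-snf`, GEN-14).
NEW WORK of the cell (elementary asymptotic statistics: the strong law, Slutsky's theorem and one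
implication of the portmanteau theorem, from Mathlib), not a published result; nothing is cited as
a fact (C. H. Bennett 1976 named only).  Continuation of `NCMCGeneralSpaceTwoSampleCLT.lean`
(GEN-12: for paired independent evolutions and a positive statistic `α`,
`√n (ΔF̂_{α,n} − ΔF) →d N(0, V₁(α))`, `V₁(α) = (E_F[(αe^{−W})²]/E_F[αe^{−W}]² − 1) + (E_R[α²]/E_R[α]² − 1)`)
and of `NCMCGeneralSpaceStudentizedCLT.lean` (GEN-13: the one-sample analogue for `ΔF̂` studentized
by `1/essHat − 1`).  The two terms of Bennett's functional `V₁(α)` are `1/ESS − 1` of the forward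
weights `α e^{−W}` and of the reverse weights `α`; this file shows that the PLUG-IN
`(1/essHat_F,n − 1) + (1/essHat_R,n − 1)` — the two reported Kish fractions — studentizes the
two-sample estimate into an asymptotically standard normal pivot.

## Setting and content

`μ` a probability law, `w > 0` measurable in `L²(μ)`: `tendsto_inv_essHat_sub_one_ae` —
`1/essHat_n − 1 → E_μ w²/(E_μ w)² − 1` a.s. (GEN-11's `tendsto_essHat_ae`).
For a Crooks pair `(κF, κR, s, e, W)` from `ν₀` to `ν₁` with `e^{−ΔF} = Z₁/Z₀`, a positive measurable
statistic `α` with `α e^{−W} ∈ L²(P_F)`, `α ∈ L²(P_R)` and `V₁(α) > 0`, along the run of independent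
PAIRS `ω : ℕ → E × E` under `Measure.infinitePi (fun _ => P_F ⊗ P_R)`, with
`R_n = Σ_{i<n} α(ε_i)e^{−W(ε_i)}/Σ_{i<n} α(ε'_i)`, `ΔF̂_{α,n} = −log R_n`, and the two Kish fractions
`essHat_F,n = essHat(α(ε_i)e^{−W(ε_i)})_{i<n}`, `essHat_R,n = essHat(α(ε'_i))_{i<n}`:

* `CrooksPair.tendsto_twoSample_pluginVariance_ae` — `(1/essHat_F,n − 1) + (1/essHat_R,n − 1) → V₁(α)`
  almost surely (bookkeeping: the product-law integrals are the `P_F` / `P_R` integrals);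
* **`CrooksPair.tendstoInDistribution_twoSample_studentized`** —
  `√n (ΔF̂_{α,n} − ΔF) / √((1/essHat_F,n − 1) + (1/essHat_R,n − 1)) →d N(0, 1)`;
* **`CrooksPair.tendsto_measure_abs_twoSample_sub_le`** — COVERAGE: the probability that
  `|√n (ΔF̂_{α,n} − ΔF)| ≤ z √((1/essHat_F,n − 1) + (1/essHat_R,n − 1))`, i.e. that `ΔF` lies in
  `ΔF̂ ± z·err` with `err_n = √(((1/essHat_F,n − 1) + (1/essHat_R,n − 1))/n)`, tends to `N(0,1)([−z, z])`.
  Reading for the engine (`estimators.bar` / `twosided` with a FIXED statistic, e.g. the Fermi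
  weight at a pilot constant): for independent paired evolutions the honest error bar of the
  two-sample estimate is `√((1/ess_F − 1 + 1/ess_R − 1)/n)` with the Kish fractions of the two
  weighted samples — both legs' effective sample sizes must be large.

Scope / NOT CLAIMED: equal sample sizes and independent pairs only; a FIXED statistic `α` (the
self-consistent BAR iteration is not analysed); asymptotic coverage only, no rate; the degenerate
case `V₁(α) = 0` is excluded; no value for any concrete protocol.
-/

namespace Summit.Ventures.LatticeQCDFlow.Exactness.GeneralNCMC

open MeasureTheory ProbabilityTheory Set Filter Finset
open scoped ENNReal NNReal Topology

variable {E : Type*} [MeasurableSpace E]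

section IID

variable (μ : Measure E) [IsProbabilityMeasure μ]

/-- **`1/essHat_n − 1 → E_μ w²/(E_μ w)² − 1` almost surely** for a positive measurable weight in
`L²(μ)` along an infinite i.i.d. run (GEN-11's strong consistency of the Kish fraction). -/
theorem tendsto_inv_essHat_sub_one_ae {w : E → ℝ} (hwm : Measurable w) (hwpos : ∀ a, 0 < w a)
    (hL2 : MemLp w 2 μ) :
    ∀ᵐ ω ∂(Measure.infinitePi fun _ : ℕ => μ),
      Tendsto (fun n : ℕ => 1 / essHat (fun i : Fin n => w (ω i)) - 1) atTop
        (𝓝 ((∫ a, w a ^ 2 ∂μ) / (∫ a, w a ∂μ) ^ 2 - 1)) := by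
  have hwi : Integrable w μ := hL2.integrable one_le_two
  have hθ : 0 < ∫ a, w a ∂μ := by
    rw [integral_pos_iff_support_of_nonneg (fun a => (hwpos a).le) hwi]
    have hsupp : Function.support w = univ := by
      ext a
      simp only [Function.mem_support, mem_univ, iff_true]
      exact (hwpos a).ne'
    rw [hsupp, measure_univ]
    exact one_pos
  have hsq : ∫ a, w a ^ 2 ∂μ ≠ 0 := by
    have h2 : 0 < ∫ a, w a ^ 2 ∂μ := by
      rw [integral_pos_iff_support_of_nonneg (fun a => sq_nonneg (w a)) hL2.integrable_sq]
      have hsupp : Function.support (fun a => w a ^ 2) = univ := by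
        ext a
        simp only [Function.mem_support, mem_univ, iff_true]
        exact (pow_pos (hwpos a) 2).ne'
      rw [hsupp, measure_univ]
      exact one_pos
    exact h2.ne'
  filter_upwards [tendsto_essHat_ae μ hwm hL2 hsq] with ω hω
  have hlim : Tendsto (fun n : ℕ => 1 / essHat (fun i : Fin n => w (ω i)) - 1) atTop
      (𝓝 (1 / ((∫ a, w a ∂μ) ^ 2 / ∫ a, w a ^ 2 ∂μ) - 1)) :=
    (tendsto_const_nhds.div hω (div_ne_zero (pow_ne_zero 2 hθ.ne') hsq)).sub_const 1
  rwa [one_div_div] at hlim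

end IID

/-! ## For a Crooks pair: the two-sample estimate studentized by the two Kish fractions -/

namespace CrooksPair

variable {Ω : Type*} [MeasurableSpace Ω]
variable {ν₀ ν₁ : Measure Ω} {κF κR : Kernel Ω E} {s e : E → Ω} {W : E → ℝ}
variable {Ω' : Type*} [MeasurableSpace Ω'] {P' : Measure Ω'} [IsProbabilityMeasure P']

/-- **The plug-in of Bennett's functional is strongly consistent**: along the run of independent
pairs, `(1/essHat_F,n − 1) + (1/essHat_R,n − 1) → V₁(α)` almost surely. -/
theorem tendsto_twoSample_pluginVariance_ae [IsFiniteMeasure ν₀] [IsFiniteMeasure ν₁]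
    [IsMarkovKernel κF] [IsMarkovKernel κR] (h0 : ν₀ univ ≠ 0) (h1 : ν₁ univ ≠ 0)
    (h : CrooksPair ν₀ ν₁ κF κR s e W) {α : E → ℝ} (hαm : Measurable α) (hαpos : ∀ ε, 0 < α ε)
    (hA2 : MemLp (fun ε => α ε * Real.exp (-W ε)) 2 (fwdPathLaw ν₀ κF))
    (hB2 : MemLp α 2 (fwdPathLaw ν₁ κR)) :
    haveI := isProbabilityMeasure_fwdPathLaw ν₀ h0 κF
    haveI := isProbabilityMeasure_fwdPathLaw ν₁ h1 κR
    ∀ᵐ ω ∂(Measure.infinitePi fun _ : ℕ => (fwdPathLaw ν₀ κF).prod (fwdPathLaw ν₁ κR)),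
      Tendsto (fun n : ℕ =>
        (1 / essHat (fun i : Fin n => α (ω i).1 * Real.exp (-W (ω i).1)) - 1) +
          (1 / essHat (fun i : Fin n => α (ω i).2) - 1)) atTop
        (𝓝 (((∫ ε, (α ε * Real.exp (-W ε)) ^ 2 ∂(fwdPathLaw ν₀ κF)) /
            (∫ ε, α ε * Real.exp (-W ε) ∂(fwdPathLaw ν₀ κF)) ^ 2 - 1) +
          ((∫ ε, α ε ^ 2 ∂(fwdPathLaw ν₁ κR)) / (∫ ε, α ε ∂(fwdPathLaw ν₁ κR)) ^ 2 - 1))) := by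
  haveI := isProbabilityMeasure_fwdPathLaw ν₀ h0 κF
  haveI := isProbabilityMeasure_fwdPathLaw ν₁ h1 κR
  set μ := (fwdPathLaw ν₀ κF).prod (fwdPathLaw ν₁ κR) with hμ
  have hfst := measurePreserving_fst (μ := fwdPathLaw ν₀ κF) (ν := fwdPathLaw ν₁ κR)
  have hsnd := measurePreserving_snd (μ := fwdPathLaw ν₀ κF) (ν := fwdPathLaw ν₁ κR)
  have ham : Measurable fun p : E × E => α p.1 * Real.exp (-W p.1) :=
    (hαm.mul (Real.measurable_exp.comp h.measurable_W.neg)).comp measurable_fst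
  have hbm : Measurable fun p : E × E => α p.2 := hαm.comp measurable_snd
  have ha2 : MemLp (fun p : E × E => α p.1 * Real.exp (-W p.1)) 2 μ := hA2.comp_measurePreserving hfst
  have hb2 : MemLp (fun p : E × E => α p.2) 2 μ := hB2.comp_measurePreserving hsnd
  have hia : ∫ p, α p.1 * Real.exp (-W p.1) ∂μ = ∫ ε, α ε * Real.exp (-W ε) ∂(fwdPathLaw ν₀ κF) :=
    integral_comp_of_measurePreserving hfst (hA2.integrable one_le_two).aestronglyMeasurable
  have hia2 : ∫ p, (α p.1 * Real.exp (-W p.1)) ^ 2 ∂μ =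
      ∫ ε, (α ε * Real.exp (-W ε)) ^ 2 ∂(fwdPathLaw ν₀ κF) :=
    integral_comp_of_measurePreserving hfst (g := fun ε => (α ε * Real.exp (-W ε)) ^ 2)
      hA2.integrable_sq.aestronglyMeasurable
  have hib : ∫ p, α p.2 ∂μ = ∫ ε, α ε ∂(fwdPathLaw ν₁ κR) :=
    integral_comp_of_measurePreserving hsnd (hB2.integrable one_le_two).aestronglyMeasurable
  have hib2 : ∫ p, α p.2 ^ 2 ∂μ = ∫ ε, α ε ^ 2 ∂(fwdPathLaw ν₁ κR) :=
    integral_comp_of_measurePreserving hsnd (g := fun ε => α ε ^ 2) hB2.integrable_sq.aestronglyMeasurable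
  have hT1 := tendsto_inv_essHat_sub_one_ae μ ham (fun p => mul_pos (hαpos p.1) (Real.exp_pos _)) ha2
  have hT2 := tendsto_inv_essHat_sub_one_ae μ hbm (fun p => hαpos p.2) hb2
  rw [hia, hia2] at hT1
  rw [hib, hib2] at hT2
  filter_upwards [hT1, hT2] with ω hω1 hω2
  exact hω1.add hω2

/-- **Studentized two-sample CLT.**  For every Crooks pair with `e^{−ΔF} = Z₁/Z₀`, every positive
measurable statistic `α` with `α e^{−W} ∈ L²(P_F)`, `α ∈ L²(P_R)` and `V₁(α) > 0`, along an
infinite run of independent pairs: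
`√n (ΔF̂_{α,n} − ΔF) / √((1/essHat_F,n − 1) + (1/essHat_R,n − 1)) →d N(0, 1)`. -/
theorem tendstoInDistribution_twoSample_studentized [IsFiniteMeasure ν₀] [IsFiniteMeasure ν₁]
    [IsMarkovKernel κF] [IsMarkovKernel κR] (h0 : ν₀ univ ≠ 0) (h1 : ν₁ univ ≠ 0)
    (h : CrooksPair ν₀ ν₁ κF κR s e W) {α : E → ℝ} (hαm : Measurable α) (hαpos : ∀ ε, 0 < α ε)
    (hA2 : MemLp (fun ε => α ε * Real.exp (-W ε)) 2 (fwdPathLaw ν₀ κF))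
    (hB2 : MemLp α 2 (fwdPathLaw ν₁ κR)) {ΔF : ℝ}
    (hΔF : Real.exp (-ΔF) = ((ν₀ univ)⁻¹ * ν₁ univ).toReal)
    (hV : 0 < ((∫ ε, (α ε * Real.exp (-W ε)) ^ 2 ∂(fwdPathLaw ν₀ κF)) /
          (∫ ε, α ε * Real.exp (-W ε) ∂(fwdPathLaw ν₀ κF)) ^ 2 - 1) +
        ((∫ ε, α ε ^ 2 ∂(fwdPathLaw ν₁ κR)) / (∫ ε, α ε ∂(fwdPathLaw ν₁ κR)) ^ 2 - 1))
    {Z : Ω' → ℝ} (hZ : HasLaw Z (gaussianReal 0 1) P') :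
    haveI := isProbabilityMeasure_fwdPathLaw ν₀ h0 κF
    haveI := isProbabilityMeasure_fwdPathLaw ν₁ h1 κR
    TendstoInDistribution
      (fun (n : ℕ) (ω : ℕ → E × E) => √(n : ℝ) *
          (-Real.log ((∑ i ∈ range n, α (ω i).1 * Real.exp (-W (ω i).1)) /
            (∑ i ∈ range n, α (ω i).2)) - ΔF) /
        √((1 / essHat (fun i : Fin n => α (ω i).1 * Real.exp (-W (ω i).1)) - 1) +
          (1 / essHat (fun i : Fin n => α (ω i).2) - 1)))
      atTop Z (fun _ => Measure.infinitePi fun _ : ℕ => (fwdPathLaw ν₀ κF).prod (fwdPathLaw ν₁ κR))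
      P' := by
  haveI := isProbabilityMeasure_fwdPathLaw ν₀ h0 κF
  haveI := isProbabilityMeasure_fwdPathLaw ν₁ h1 κR
  set μ := (fwdPathLaw ν₀ κF).prod (fwdPathLaw ν₁ κR) with hμ
  set P := Measure.infinitePi fun _ : ℕ => μ with hP
  set V := ((∫ ε, (α ε * Real.exp (-W ε)) ^ 2 ∂(fwdPathLaw ν₀ κF)) /
          (∫ ε, α ε * Real.exp (-W ε) ∂(fwdPathLaw ν₀ κF)) ^ 2 - 1) +
        ((∫ ε, α ε ^ 2 ∂(fwdPathLaw ν₁ κR)) / (∫ ε, α ε ∂(fwdPathLaw ν₁ κR)) ^ 2 - 1) with hVdef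
  have hsV : √V ≠ 0 := (Real.sqrt_pos.2 hV).ne'
  -- `Y = √V · Z ~ N(0, V)`: GEN-12's two-sample CLT applies with this limit variable
  have hY : HasLaw (fun ω' => √V * Z ω') (gaussianReal 0 V.toNNReal) P' := by
    have h := gaussianReal_const_mul hZ (√V)
    rw [mul_zero, mul_one] at h
    convert h using 3
    apply NNReal.eq
    rw [Real.coe_toNNReal _ hV.le, NNReal.coe_mk, Real.sq_sqrt hV.le]
  have clt := h.tendstoInDistribution_twoSample_freeEnergy h0 h1 hαm hαpos hA2 hB2 hΔF hY
  -- the studentizing factor converges in probability to `(√V)⁻¹`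
  have ham : Measurable fun p : E × E => α p.1 * Real.exp (-W p.1) :=
    (hαm.mul (Real.measurable_exp.comp h.measurable_W.neg)).comp measurable_fst
  have hbm : Measurable fun p : E × E => α p.2 := hαm.comp measurable_snd
  have hUmeas : ∀ n : ℕ, AEMeasurable (fun ω : ℕ → E × E =>
      (√((1 / essHat (fun i : Fin n => α (ω i).1 * Real.exp (-W (ω i).1)) - 1) +
        (1 / essHat (fun i : Fin n => α (ω i).2) - 1)))⁻¹) P := fun n =>
    ((((measurable_essHat_run ham n).const_div 1).sub_const 1).add
      (((measurable_essHat_run hbm n).const_div 1).sub_const 1)).sqrt.inv.aemeasurable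
  have hU : TendstoInMeasure P (fun (n : ℕ) (ω : ℕ → E × E) =>
      (√((1 / essHat (fun i : Fin n => α (ω i).1 * Real.exp (-W (ω i).1)) - 1) +
        (1 / essHat (fun i : Fin n => α (ω i).2) - 1)))⁻¹) atTop (fun _ => (√V)⁻¹) := by
    refine tendstoInMeasure_of_tendsto_ae (fun n => (hUmeas n).aestronglyMeasurable) ?_
    filter_upwards [h.tendsto_twoSample_pluginVariance_ae h0 h1 hαm hαpos hA2 hB2] with ω hω
    exact (hω.sqrt).inv₀ hsV
  have slutsky := clt.continuous_comp_prodMk_of_tendstoInMeasure_const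
    (g := fun p : ℝ × ℝ => p.1 * p.2) (by fun_prop) hU hUmeas
  refine slutsky.congr (fun n => Eventually.of_forall fun ω => ?_)
    (Eventually.of_forall fun ω' => ?_)
  · simp only [div_eq_mul_inv]
  · show √V * Z ω' * (√V)⁻¹ = Z ω'
    rw [mul_comm (√V) (Z ω'), mul_inv_cancel_right₀ hsV]

/-- **The two-sample interval `ΔF̂ ± z·err` is asymptotically honest.**  With
`err_n = √(((1/essHat_F,n − 1) + (1/essHat_R,n − 1))/n)`, for every `z ≥ 0` the probability that
`|√n (ΔF̂_{α,n} − ΔF)| / √((1/essHat_F,n − 1) + (1/essHat_R,n − 1)) ≤ z` converges to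
`gaussianReal 0 1 [−z, z] = P(|N(0,1)| ≤ z)`. -/
theorem tendsto_measure_abs_twoSample_sub_le [IsFiniteMeasure ν₀] [IsFiniteMeasure ν₁]
    [IsMarkovKernel κF] [IsMarkovKernel κR] (h0 : ν₀ univ ≠ 0) (h1 : ν₁ univ ≠ 0)
    (h : CrooksPair ν₀ ν₁ κF κR s e W) {α : E → ℝ} (hαm : Measurable α) (hαpos : ∀ ε, 0 < α ε)
    (hA2 : MemLp (fun ε => α ε * Real.exp (-W ε)) 2 (fwdPathLaw ν₀ κF))
    (hB2 : MemLp α 2 (fwdPathLaw ν₁ κR)) {ΔF : ℝ}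
    (hΔF : Real.exp (-ΔF) = ((ν₀ univ)⁻¹ * ν₁ univ).toReal)
    (hV : 0 < ((∫ ε, (α ε * Real.exp (-W ε)) ^ 2 ∂(fwdPathLaw ν₀ κF)) /
          (∫ ε, α ε * Real.exp (-W ε) ∂(fwdPathLaw ν₀ κF)) ^ 2 - 1) +
        ((∫ ε, α ε ^ 2 ∂(fwdPathLaw ν₁ κR)) / (∫ ε, α ε ∂(fwdPathLaw ν₁ κR)) ^ 2 - 1))
    {z : ℝ} (hz : 0 ≤ z) :
    haveI := isProbabilityMeasure_fwdPathLaw ν₀ h0 κF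
    haveI := isProbabilityMeasure_fwdPathLaw ν₁ h1 κR
    Tendsto (fun n : ℕ => (Measure.infinitePi fun _ : ℕ => (fwdPathLaw ν₀ κF).prod (fwdPathLaw ν₁ κR))
        {ω | |√(n : ℝ) *
            (-Real.log ((∑ i ∈ range n, α (ω i).1 * Real.exp (-W (ω i).1)) /
              (∑ i ∈ range n, α (ω i).2)) - ΔF) /
          √((1 / essHat (fun i : Fin n => α (ω i).1 * Real.exp (-W (ω i).1)) - 1) +
            (1 / essHat (fun i : Fin n => α (ω i).2) - 1))| ≤ z})
      atTop (𝓝 (gaussianReal 0 1 (Icc (-z) z))) := by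
  haveI := isProbabilityMeasure_fwdPathLaw ν₀ h0 κF
  haveI := isProbabilityMeasure_fwdPathLaw ν₁ h1 κR
  have hlim := h.tendstoInDistribution_twoSample_studentized h0 h1 hαm hαpos hA2 hB2 hΔF hV
    (P' := gaussianReal 0 1) (Z := id) HasLaw.id
  have hnull : ((gaussianReal 0 1).map id) (frontier (Icc (-z) z)) = 0 := by
    rw [Measure.map_id, frontier_Icc (by linarith : -z ≤ z)]
    haveI := nullSingletonClass_gaussianReal (μ := 0) (v := 1) one_ne_zero
    exact (Set.toFinite {-z, z}).measure_zero _
  have key := ProbabilityMeasure.tendsto_measure_of_null_frontier_of_tendsto' hlim.tendsto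
    (E := Icc (-z) z) (by simpa using hnull)
  simp only [ProbabilityMeasure.coe_mk, Measure.map_id] at key
  refine key.congr fun n => ?_
  rw [Measure.map_apply_of_aemeasurable (hlim.forall_aemeasurable n) measurableSet_Icc]
  congr 1
  ext ω
  simp only [Set.mem_preimage, Set.mem_Icc, mem_setOf_eq, abs_le]

end CrooksPair

end Summit.Ventures.LatticeQCDFlow.Exactness.GeneralNCMC
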